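import Literature.Computability.AlgebraicComplexity.ValiantBooleanBridgeProofs
import HarnessLib

/-!
# Kabanets–Impagliazzo, Cor. 12: the graph of the `0/1` permanent is in `NSUBEXP` — decomposition

Companion of `ValiantBooleanBridgeProofs.lean` for the named fact
`Literature.Computability.AlgebraicComplexity.permanent01Graph_mem_NSUBEXP_of_PIT`
(Kabanets–Impagliazzo, STOC 2003, Cor. 12, p. 358):

  `PIT ∈ NSUBEXP → (PER_n) has p-bounded constant-free circuits → permanent01Graph ∈ NSUBEXP`.

The printed proof (p. 358) is: "nondeterministically guess a poly(n)-size arithmetic circuit `C`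
computing Perm on `n × n` integer matrices. Since, by our assumption, testing whether `C` is
indeed computing Perm can be done in NSUBEXP by Lemma 11 [ACP is polynomial-time many-one
reducible to ACIT, via the identities (1) `p₁(x) − x ≡ 0`, (2) `pᵢ(X) − Σⱼ x_{1j} p_{i−1}(Xⱼ) ≡ 0`],
we can verify in nondeterministic subexponential time that the guessed arithmetic circuit indeed
computes Perm over `ℤ`. Once we have such a circuit, we can deterministically evaluate it at a
given 0-1 matrix". Over the tree's verifier-form `NTIME` (`Nondeterministic.lean`) and its string
classes this is the composite of three independent statements, which this file separates and
**assembles** (`permanent01Graph_mem_NSUBEXP_of_PIT_of_facts`):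

| step of the printed proof | statement | where |
|---|---|---|
| Lemma 11 + "guess a circuit … evaluate it" | `permanent01Graph_polyExists_preimage_PIT` (named fact) | here |
| "ACP ≤ₘᵖ ACIT and ACIT ∈ NSUBEXP give ACP ∈ NSUBEXP" | closure of `NSUBEXP` under `≤ₚ` (hypothesis `hK`; the named fact `NSUBEXP_of_karpReducible` of `Complexity/NSubexpKarp.lean`) | `Complexity/` |
| "nondeterministically guess" in front of an NSUBEXP test | `polyExists NSUBEXP ⊆ NSUBEXP` (named fact `polyExists_NSUBEXP_subset_NSUBEXP`, `AaronsonVanMelkebeek2011.lean`) | `Complexity/` |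

The first line is the permanent-specific content. It is stated as ONE polynomial-time
nondeterministic many-one reduction of `permanent01Graph` to `PITLanguage`: there are `f ∈ FP` and
a polynomial `p` with `x ∈ permanent01Graph ↔ ∃ y, |y| ≤ p |x| ∧ f ⟨x, y⟩ ∈ PITLanguage`. The
intended `f` writes, from the input `(M, v)` and guessed gate lists `P₀, …, Pₙ` (read totally from
`y`), ONE division-free circuit over `ℤ` whose output is the sum of the squares of
`P₀ − 1`, `Pᵢ(X) − Σ_{j<i} x_{0j} · P_{i−1}(X with row 0 and column j deleted)` (`1 ≤ i ≤ n`,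
Lemma 11 (1)–(2), each use of `P_{i−1}` being a relocated copy behind its own input layer) and
`Pₙ(M) − v`; a sum of squares of integer polynomials vanishes only termwise, so the instance is in
`PITLanguage` iff all identities hold, which forces `v = per M` by Laplace expansion along the
first row (`Matrix.permanent_eq_sum_row_zero`) — for EVERY guessed string, while the p-bounded
constant-free circuits of the hypothesis supply a polynomial-length accepted guess. Deviation
from the printed proof, recorded here and in the fact's docstring: the final step "evaluate it at
a given 0-1 matrix … modulo `2^{n log n + 1}`" is replaced by the variable-free identity
`Pₙ(M) − v ≡ 0` inside the same ACIT instance (one query instead of a query and an evaluation);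
the statement proved from it, Cor. 12, is unchanged.

## References

* V. Kabanets, R. Impagliazzo, *Derandomizing polynomial identity tests means proving circuit
  lower bounds*, STOC 2003, 355–364: §2.1 (p. 357, `NSUBEXP`, "Perm ∈ NTIME(t)"), Lemma 11 and
  Cor. 12 with proofs (p. 358); journal version Comput. Complexity 13 (2004) 1–46.
* S. Aaronson, D. van Melkebeek, *On circuit lower bounds from derandomization*, Theory of
  Computing 7 (2011), proof of Lemma 3.1 (the `∃` in front of an NSUBEXP predicate).
* H. Minc, *Permanents*, Encyclopedia Math. Appl. 6 (1978), §1.2 (Laplace expansion).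
-/

noncomputable section

namespace Literature.Computability.AlgebraicComplexity

open _root_.Computability Complexity QuantumComplexity Nondeterministic
open scoped Complexity.Notation

/-! ### The permanent-specific step: a nondeterministic many-one reduction to `PIT` -/

/-- **Kabanets–Impagliazzo 2003, Lemma 11 with the guessing/evaluation step of the proof of
Cor. 12 (p. 358)**, as one polynomial-time nondeterministic many-one reduction of the graph of the
`0/1` permanent to ACIT: if `(PER_n)` has p-bounded constant-free circuits
(`constantFreeComplexity`, the hypothesis form of pnp.S39), then there are a string function
`f ∈ FP` and a polynomial `p` such that for every string `x`,
`x ∈ permanent01Graph ↔ ∃ y, |y| ≤ p(|x|) ∧ f (boolPair x y) ∈ PITLanguage`.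
Printed: Lemma 11 "The language ACP = {C | C is an arithmetic circuit computing Perm over ℤ} is
polynomial-time many-one reducible to ACIT", by the identities (1) `h₁(x) = p₁(x) − x ≡ 0`,
(2) `hᵢ(X) = pᵢ(X) − Σ_{j=1}^{i} x_{1j} p_{i−1}(Xⱼ) ≡ 0` (`Xⱼ` the `j`-th minor along the first
row), and proof of Cor. 12: "nondeterministically guess a poly(n)-size arithmetic circuit …
verify … by Lemma 11 … evaluate it at a given 0-1 `n × n` matrix". Here `y` is the guess (gate
lists `P₀, …, Pₙ`, read totally), `f` writes one division-free integer circuit (the tree's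
`PITLanguage` instances `⟨m, C⟩`, `C : ArithCircuit ℤ (Fin m)`) whose output is the sum of the
squares of `P₀ − 1`, of the `hᵢ` (each use of `P_{i−1}` a relocated copy behind its own input
layer) and of `Pₙ(M) − v`; DEVIATION from the printed proof: the last square replaces the printed
modular evaluation "modulo `2^{n log n + 1}`", so that membership is ONE ACIT query. Soundness
(for every `y`): a sum of squares over `ℤ` vanishes only termwise, and the identities force
`Pᵢ = per_i` by Laplace expansion along the first row, whence `v = per M`; completeness: the
p-bounded constant-free circuits have polynomial-length code words and satisfy all identities.
Named fact (discharge = the circuit arithmetic over `ArithCircuit` + an `FP` brick program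
writing the instance). [cite: KabanetsImpagliazzo2003, Lemma 11 and proof of Cor. 12 (p. 358)] -/
def permanent01Graph_polyExists_preimage_PIT : Prop :=
  IsPBounded (fun n => constantFreeComplexity (perPoly (Fin n) ℤ)) →
    ∃ f : List Bool → List Bool, f ∈ FP ∧ ∃ p : Polynomial ℕ, ∀ x : List Bool,
      x ∈ permanent01Graph ↔
        ∃ y : List Bool, y.length ≤ p.eval x.length ∧ f (boolPair x y) ∈ PITLanguage

/-! ### Assembly of Cor. 12 from the three statements -/

/-- **`permanent01Graph ∈ ∃ᵖ · NSUBEXP`** under `PIT ∈ NSUBEXP` and p-bounded constant-free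
circuits for `(PER_n)`, from the reduction fact and the closure of `NSUBEXP` under `≤ₚ`
(hypothesis `hK`, literally the named fact `NSUBEXP_of_karpReducible` of
`Complexity/NSubexpKarp.lean`): the inner language is the `FP`-preimage `{w | f w ∈ PITLanguage}`.
Kabanets–Impagliazzo 2003, proof of Cor. 12: "testing whether `C` is indeed computing Perm can be
done in NSUBEXP by Lemma 11". [cite: KabanetsImpagliazzo2003, proof of Cor. 12 (p. 358)] -/
theorem permanent01Graph_mem_polyExists_NSUBEXP (hR : permanent01Graph_polyExists_preimage_PIT)
    (hK : ∀ ⦃L L' : Language Bool⦄, L ≤ₚ L' → L' ∈ NSUBEXP → L ∈ NSUBEXP)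
    (hPIT : PITLanguage ∈ NSUBEXP)
    (hper : IsPBounded (fun n => constantFreeComplexity (perPoly (Fin n) ℤ))) :
    permanent01Graph ∈ polyExists NSUBEXP := by
  obtain ⟨f, hf, p, hp⟩ := hR hper
  exact ⟨{w | f w ∈ PITLanguage}, hK ⟨f, hf, fun _ => Iff.rfl⟩ hPIT, p, hp⟩

/-- **Kabanets–Impagliazzo 2003, Cor. 12, from the three statements**: the reduction fact
`permanent01Graph_polyExists_preimage_PIT`, the closure of `NSUBEXP` under Karp reductions
(`hK`, the named fact `NSUBEXP_of_karpReducible`), and `polyExists NSUBEXP ⊆ NSUBEXP` (`hE`, the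
named fact `polyExists_NSUBEXP_subset_NSUBEXP`) give `permanent01Graph_mem_NSUBEXP_of_PIT`
("Suppose that ACIT over `ℤ` is in NSUBEXP. If Perm over `ℤ` is computable by polynomial-size
arithmetic circuits … then Perm ∈ NSUBEXP"). When the three are discharged,
`permanent01Graph_mem_NSUBEXP_of_PIT_holds` is this theorem applied to their `_holds` theorems.
[cite: KabanetsImpagliazzo2003, Cor. 12 (p. 358)] -/
theorem permanent01Graph_mem_NSUBEXP_of_PIT_of_facts
    (hR : permanent01Graph_polyExists_preimage_PIT)
    (hK : ∀ ⦃L L' : Language Bool⦄, L ≤ₚ L' → L' ∈ NSUBEXP → L ∈ NSUBEXP)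
    (hE : polyExists NSUBEXP ⊆ NSUBEXP) : permanent01Graph_mem_NSUBEXP_of_PIT :=
  fun hPIT hper => hE (permanent01Graph_mem_polyExists_NSUBEXP hR hK hPIT hper)

end Literature.Computability.AlgebraicComplexity

end
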